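import Summits.Ventures.AbcSig.Rows.XTemplateC2a
import Summits.Ventures.AbcSig.Rows.C2aL773A0

/-!
# Venture AbcSig — ROW `C2aL773A0AB`: `773^m·xⁿ + yⁿ = z²` (second distribution, by symmetry), class `a = 0`, over the level files 24736 = 32·773 (norm-form certificates) and 1546 = 2·773 (norm-form certificates) (GENERATED by p-lean g4 `gen4/c2arow2.py`)

HONEST FRAMING. A row of a COMPUTATION cell (`pub-abcsig`); a CONDITIONAL theorem, no claim on ABC or any summit.
Hypotheses: `BS04Package` (CITED: [BS04] Lemma 3.3 + (3.1) + Lemma 4.2); `DataComplete` at both levels and `RefinesCPSymAll` at the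
norm-form level(s) (COMPUTED: certified engine-1 level files; `Sieve/CharpolyCert.lean` / `Sieve/CharpolyTwist.lean`);
and the listed per-orbit exclusions `hX_…` (CITED: the row of record's module closures — M4 Kraus / M6 / M8 / [BS04, Prop 4.4/4.6] as its R3
names them; nothing of those is checked here). Exponent range: prime `n ≥ 11`, `n ≠ 773`, n ∉ [11, 37, 101]; `B = 2^0·773^m`, `1 ≤ m < n`
(RULING H1 reduced exponents).
Levels: 24736 = 32·773 (msym 0.5.7 big-orbit mode, kit j182084: ten orbits of degrees 1, 1, 82, 90, 90, 94, 98, 103, 103, 110 — NO θ-coordinates exist for the big orbits, so the norm-form certificate is the only possible kernel check; all ten orbits certified from their characteristic polynomials) and 1546 = 2·773. Residual of record R = {11, 37, 101} EXCLUDED in the statement (1546.6 @ 11: M4 leaves classes; 24736.7 @ 37 and 24736.6 @ 101: sieve survivors of the degree-98 / degree-94 orbits). CITED: 1546.9 (degree 21) @ 43 by the cell's module M6 (Eisenstein) certificate M6_N1546_1546.9_n43 (43 ∣ 773 + 1; p1, referee-verified) — not re-checked in the kernel here.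
Row of record: `census/rows/C2a/C2a-l773-a0.md` (sha16 `66d8581b70ee1c82`; R8-signed 2026-08-23T05:33:58Z by referee (ref-g26)).
-/

namespace Summit.Ventures.AbcSig

/-- Row `C2aL773A0AB`: `a = 0`, second distribution `(773^m, 1)` — the first with `x, y` swapped (`IsPrimitiveSolution.swap`). -/
theorem xrow_C2aL773A0AB (M : NewformModel) (hP : M.BS04Package)
    (hD1546 : M.DataComplete 1546 level1546Orbits) (hCP1546 : M.RefinesCPSymAll 1546 level1546CP)
    (hD24736 : M.DataComplete 24736 level24736Orbits) (hCP24736 : M.RefinesCPSymAll 24736 level24736CP)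
    (n : ℕ) (hn : n.Prime) (hmin : 11 ≤ n) (hnℓ : n ≠ 773) (hres : n ∉ ([11, 37, 101] : List ℕ)) (m : ℕ) (hm : 1 ≤ m) (hmn : m < n)
    (hX_orbit_1546_9 : n ∈ ([43] : List ℕ) → M.Excludes 1546 orbit_1546_9
      (famB (2 ^ 0 * 773 ^ m) n (fun _ _ => True)))
    (x y z : ℤ) (hxy1 : x * y ≠ 1) (hxy2 : x * y ≠ -1) : ¬ IsPrimitiveSolution (773 ^ m) (2 ^ 0) 1 n x y z := by
  intro h
  have h' : IsPrimitiveSolution 1 (2 ^ 0 * 773 ^ m) 1 n y x z := by simpa only [pow_zero, one_mul] using h.swap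
  exact xrow_C2aL773A0 M hP  hD1546 hCP1546 hD24736 hCP24736 n hn hmin hnℓ hres m hm hmn hX_orbit_1546_9 y x z (by rwa [mul_comm]) (by rwa [mul_comm]) h'

end Summit.Ventures.AbcSig
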